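import Literature.MathematicalPhysics.QuantumLattice.KomaPiFluxCoulombSuperconductingOrder
import Literature.MathematicalPhysics.QuantumLattice.KomaPiFluxGroundStateOrder
import HarnessLib

/-!
# Koma 2022, Theorem 2.1 as printed, with the Coulomb repulsion: `m_LRO ≥ 1/50` for
# `|κ| ≤ g/1000`, `0 ≤ g' ≤ g/2000`, low temperature, every dimension `D ≥ 3`

T. Koma, *Nambu–Goldstone modes for superconducting lattice fermions*, arXiv:2201.13135 (2022)
[Koma2022], Theorem 2.1: "Let `d ≥ 3`, and set the external symmetry-breaking field to be `B = 0`. Then,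
there exist small positive numbers `κ̂` and `ĝ'`, and a large positive number `β_c` such that `m_LRO > 0`
for `|κ|/g ≤ κ̂` and `g'/g ≤ ĝ'`, and `β ≥ β_c`."  Here the full interaction (2.6) — the BCS pair term AND
the nearest-neighbour Coulomb repulsion `g'Σ_{|x-y|=1}(n_x - 1)(n_y - 1) = g'Σ_{bonds}Γ³_xΓ³_y` ((8.1)) — is
transcribed: `printedHamiltonianC κ g g' h B = printedHamiltonian κ g h B + H_repul(g')` ((2.4), (8.3) at
`h' = 0`), and the order parameter (2.11) is `mLROC`.

* `gibbsState_gammaOne_mul_neg_kappa_coulomb`, `lroSq_neg_kappa_coulomb`, `superconductingOrder_coulomb_abs`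
  — the sign of `κ` is a `ℤ₂` gauge which fixes `Γ¹` and `Γ³`; Theorem 2.1 in Lieb's frame for `|κ| ≤ g/1000`;
* `orbitalPhaseAut_hamiltonianC_eq_printed` — Koma's gauge-and-rotation `𝒰` (which fixes `Γ³`, hence
  `H_repul`) maps `H_Lieb(κ, -2Dg; g, g')` onto `printedHamiltonianC` up to the constant `Dg|Λ|/2`;
* `re_gibbsState_printedOrder_sq_coulomb`, `mLROC_eq_sqrt_lroSq` — `m^{(Λ)}_LRO = √(lroSq β H_C)`;
* **`printed_superconductingOrder_coulomb`** — THEOREM 2.1 as printed, with `κ̂ = 1/1000`, `ĝ' = 1/2000`: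
  `m^{(Λ)}_LRO ≥ 1/50` for `β ≥ β₀(g, D)` on all large even tori;
* `groundState_superconductingOrder_coulomb`, `printed_groundState_superconductingOrder_coulomb` — the
  zero-temperature statements (2.13).

All statements are PROVED; no named fact.

## References

* [Koma2022] T. Koma, arXiv:2201.13135, Theorem 2.1, (2.4)–(2.13), (6.5), (8.1)–(8.3).
* [Lieb1994] E. H. Lieb, Phys. Rev. Lett. 73 (1994) 2158, p. 3 (gauge covariance).
* [Tasaki2020] H. Tasaki, *Physics and Mathematics of Quantum Many-Body Systems*, Springer 2020, App. A.
-/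

noncomputable section

namespace Literature.MathematicalPhysics.QuantumLattice

open _root_.Matrix Finset Filter Topology HubbardWave0 PairHopRP FermionTorus LiebCutRP
open Literature.Probability.LatticeModels

namespace KomaPiFlux

attribute [local instance] LiebCutRP.decEqTorus

variable {d L : ℕ} [NeZero L]

/-! ### The sign of `κ` is a gauge, with the Coulomb term -/

/-- **The `ℤ₂` gauge `(-1)^x` on the Gibbs state, with the Coulomb term**:
`⟨Γ¹_xΓ¹_y⟩_{β,H_C(-κ)} = ⟨Γ¹_xΓ¹_y⟩_{β,H_C(κ)}` (the gauge conjugates `H_C(κ)` to `H_C(-κ)` — it fixes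
`Γ³`, hence `H_repul` — and fixes every `Γ¹_x`). [cite: Koma2022, §4.1, §8] [cite: Lieb1994, p. 3] -/
theorem gibbsState_gammaOne_mul_neg_kappa_coulomb (hL : Even L) (h2 : 2 ≤ L) (β κ U g g' : ℝ)
    (x y : FermionTorus (d + 1) L) :
    gibbsState β (hamiltonianC (-κ) U g g' (fun (_ _ : FermionTorus (d + 1) L) => (0 : ℝ)) 0) (gammaOne x * gammaOne y) =
      gibbsState β (hamiltonianC κ U g g' (fun (_ _ : FermionTorus (d + 1) L) => (0 : ℝ)) 0) (gammaOne x * gammaOne y) := by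
  obtain ⟨ph, hph_def⟩ : ∃ ph : Fin 2 → FermionTorus (d + 1) L → ℂ, ph = fun _ x => (stagSign x : ℂ) :=
    ⟨_, rfl⟩
  have hph : ∀ (σ : Fin 2) (x : FermionTorus (d + 1) L), ‖ph σ x‖ = 1 := fun σ x => by
    rcases stagSign_eq_or x with h1 | h1 <;> simp [hph_def, h1]
  have hprod : ∀ x : FermionTorus (d + 1) L, ph 0 x * ph 1 x = 1 := fun x => by
    simp only [hph_def, ← Complex.ofReal_mul, stagSign_sq, Complex.ofReal_one]
  have hH : orbitalPhaseAut (g := spinSitePhase ph) (fun _ => hph _ _)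
      (hamiltonianC κ U g g' (fun (_ _ : FermionTorus (d + 1) L) => (0 : ℝ)) 0) =
      hamiltonianC (-κ) U g g' (fun (_ _ : FermionTorus (d + 1) L) => (0 : ℝ)) 0 := by
    rw [hamiltonianC, PairHopRP.orbitalPhaseAut_hamiltonianC (G d L) hph hprod, hamiltonianC]
    congr 1
    funext σ x y
    simp only [hph_def]
    exact stagSign_mul_piFluxAmpl hL h2 κ σ x y
  have hA : orbitalPhaseAut (g := spinSitePhase ph) (fun _ => hph _ _) (gammaOne x * gammaOne y) =
      gammaOne x * gammaOne y := by
    rw [map_mul, PairHopRP.orbitalPhaseAut_gammaOne hph hprod, PairHopRP.orbitalPhaseAut_gammaOne hph hprod]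
  have key := Matrix.gibbsState_unitary_conj' (orbitalPhase_mem_unitary (g := spinSitePhase ph) fun _ => hph _ _) β
    (hamiltonianC κ U g g' (fun (_ _ : FermionTorus (d + 1) L) => (0 : ℝ)) 0) (gammaOne x * gammaOne y)
  rw [star_eq_conjTranspose, ← orbitalPhaseAut_apply (fun _ => hph _ _), ← orbitalPhaseAut_apply (fun _ => hph _ _),
    hH, hA] at key
  exact key

/-- **`lroSq` of `H_C` is even in `κ`.** [cite: Koma2022, §4.1, §8] [cite: Lieb1994, p. 3] -/
theorem lroSq_neg_kappa_coulomb (hL : Even L) (h2 : 2 ≤ L) (β κ U g g' : ℝ) :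
    lroSq β (hamiltonianC (-κ) U g g' (fun (_ _ : FermionTorus (d + 1) L) => (0 : ℝ)) 0) =
      lroSq β (hamiltonianC κ U g g' (fun (_ _ : FermionTorus (d + 1) L) => (0 : ℝ)) 0) := by
  simp only [lroSq, pairCorr, gibbsState_gammaOne_mul_neg_kappa_coulomb hL h2]

omit [NeZero L] in
/-- **Theorem 2.1 with the Coulomb term in Lieb's frame for both signs of `κ`**: `|κ| ≤ g/1000`,
`0 ≤ g' ≤ g/2000`, `U + 2g(d+1) ≤ 0`, `D = d+1 ≥ 3`. [cite: Koma2022, Theorem 2.1, §8] -/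
theorem superconductingOrder_coulomb_abs (hd : 2 ≤ d) {κ U g g' : ℝ} (hg : 0 < g) (hκg : |κ| ≤ g / 1000)
    (hg'0 : 0 ≤ g') (hg'g : g' ≤ g / 2000) (hU : U + 2 * g * (d + 1) ≤ 0) :
    ∃ β₀ : ℝ, ∃ k₀ : ℕ, 0 < β₀ ∧ ∀ β : ℝ, β₀ ≤ β → ∀ k : ℕ, k₀ ≤ k → ∀ [NeZero (2 * k)],
      (1 / 2000 : ℝ) ≤ lroSq β (hamiltonianC κ U g g' (fun (_ _ : FermionTorus (d + 1) (2 * k)) => (0 : ℝ)) 0) := by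
  rcases le_or_gt 0 κ with hκ | hκ
  · rw [abs_of_nonneg hκ] at hκg
    exact superconductingOrder_coulomb hd hg hκ hκg hg'0 hg'g hU
  · rw [abs_of_neg hκ] at hκg
    obtain ⟨β₀, k₀, hβ₀, h⟩ := superconductingOrder_coulomb hd hg (by linarith : 0 ≤ -κ) hκg hg'0 hg'g hU
    refine ⟨β₀, max k₀ 1, hβ₀, fun β hβ k hk _ => ?_⟩
    have h' := h β hβ k (le_trans (le_max_left _ _) hk)
    rwa [lroSq_neg_kappa_coulomb (even_two_mul k) (by omega)] at h'

/-! ### The printed Hamiltonian with the Coulomb repulsion and Koma's order parameter -/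

/-- **Koma's Hamiltonian (2.4) with the full interaction (2.6)** (in the form (8.3) at `h' = 0`):
`H(B, h; g') = H_hop + H_int(h) - B·O + g'Σ_{bonds}Γ³_xΓ³_y`. [cite: Koma2022, (2.4), (2.6), (8.1), (8.3)] -/
def printedHamiltonianC (κ g g' : ℝ) (h : Fin (d + 1) → FermionTorus (d + 1) L → ℝ) (B : ℝ) :
    Matrix (Finset (Orb (FermionTorus (d + 1) L))) (Finset (Orb (FermionTorus (d + 1) L))) ℂ :=
  printedHamiltonian κ g h B + coulomb (G d L) g'

/-- Unfolding lemma. [cite: Koma2022, (2.4), (8.3)] -/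
theorem printedHamiltonianC_eq (κ g g' : ℝ) (h : Fin (d + 1) → FermionTorus (d + 1) L → ℝ) (B : ℝ) :
    printedHamiltonianC κ g g' h B = printedHamiltonian κ g h B + coulomb (G d L) g' := rfl

/-- At `g' = 0` the printed Hamiltonian with the Coulomb term is the printed Hamiltonian. [cite: Koma2022, (2.4), (8.1)] -/
theorem printedHamiltonianC_zero (κ g : ℝ) (h : Fin (d + 1) → FermionTorus (d + 1) L → ℝ) (B : ℝ) :
    printedHamiltonianC κ g 0 h B = printedHamiltonian κ g h B := by
  have h0 := hamiltonianC_zero (d := d) (L := L) κ 0 g (fun _ _ => 0) B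
  rw [hamiltonianC_eq] at h0
  have hc : coulomb (G d L) (0 : ℝ) = (0 : Matrix (Finset (Orb (FermionTorus (d + 1) L))) _ ℂ) := by
    have := congrArg (fun M => M - hamiltonian κ 0 g (fun (_ _ : FermionTorus (d + 1) L) => (0 : ℝ)) B) h0
    simpa using this
  rw [printedHamiltonianC, hc, add_zero]

section Transport

variable (hL : Even L) (h4 : 4 ≤ L)
include hL h4

/-- **The identification, with the Coulomb term.** Koma's `𝒰` (a product of one-orbital phases, which
fixes every `Γ³_x` and hence `H_repul`) maps the Lieb-frame model with `U = -2Dg` onto the printed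
Hamiltonian with the Coulomb term, up to the additive constant `Dg|Λ|/2`.
[cite: Koma2022, (2.4)–(2.9), (3.5)–(3.8), §4.1–4.2, (6.5), (8.1)–(8.3)] -/
theorem orbitalPhaseAut_hamiltonianC_eq_printed (κ g g' : ℝ) (h : Fin (d + 1) → FermionTorus (d + 1) L → ℝ)
    (B : ℝ) :
    orbitalPhaseAut (g := spinSitePhase komaPhase) (fun _ => norm_komaPhase _ _)
        (hamiltonianC κ (-2 * (d + 1 : ℕ) * g) g g' (bondField h) B) =
      printedHamiltonianC κ g g' h B +
        (((d + 1 : ℕ) * g * Fintype.card (FermionTorus (d + 1) L) / 2 : ℝ) : ℂ) • 1 := by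
  rw [hamiltonianC_eq, map_add, orbitalPhaseAut_hamiltonian_eq_printed hL h4 κ g h B,
    PairHopRP.orbitalPhaseAut_coulomb (G d L) norm_komaPhase g', printedHamiltonianC]
  abel

end Transport

/-- **Koma's long-range order parameter (2.11)** for the printed Hamiltonian with the full interaction
(2.6) at `B = 0`, `h = 0`: `m^{(Λ)}_LRO = |Λ|⁻¹ √⟨[O^{(Λ)}]²⟩_β`. [cite: Koma2022, (2.5), (2.6), (2.11)] -/
def mLROC (β κ g g' : ℝ) : ℝ :=
  Real.sqrt ((gibbsState β (printedHamiltonianC κ g g' (fun (_ : Fin (d + 1)) (_ : FermionTorus (d + 1) L) => (0 : ℝ)) 0)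
      (printedOrder * printedOrder)).re) /
    (Fintype.card (FermionTorus (d + 1) L) : ℝ)

/-- At `g' = 0`, `mLROC` is `mLRO`. [cite: Koma2022, (2.11)] -/
theorem mLROC_zero (β κ g : ℝ) : mLROC (d := d) (L := L) β κ g 0 = mLRO (d := d) (L := L) β κ g := by
  rw [mLROC, mLRO, printedHamiltonianC_zero]

/-- **`⟨O²⟩_{β,H(g')} = Σ_{x,y}Re⟨Γ¹_xΓ¹_y⟩_{β,H_C}`** with `H_C = H_Lieb(κ, U = -2Dg; g, g')`.
[cite: Koma2022, (2.11), (6.5), (6.18)–(6.19), §8] -/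
theorem re_gibbsState_printedOrder_sq_coulomb (hL : Even L) (h4 : 4 ≤ L) (β κ g g' : ℝ) :
    (gibbsState β (printedHamiltonianC κ g g' (fun (_ : Fin (d + 1)) (_ : FermionTorus (d + 1) L) => (0 : ℝ)) 0)
        (printedOrder * printedOrder)).re =
      ∑ x : FermionTorus (d + 1) L, ∑ y : FermionTorus (d + 1) L,
        pairCorr β (hamiltonianC κ (-2 * (d + 1 : ℕ) * g) g g' (fun (_ _ : FermionTorus (d + 1) L) => (0 : ℝ)) 0) x y := by
  set H₀ := hamiltonianC κ (-2 * (d + 1 : ℕ) * g) g g' (fun (_ _ : FermionTorus (d + 1) L) => (0 : ℝ)) 0 with hH₀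
  have key := orbitalPhaseAut_hamiltonianC_eq_printed hL h4 κ g g'
    (fun (_ : Fin (d + 1)) (_ : FermionTorus (d + 1) L) => (0 : ℝ)) 0
  rw [bondField_zero, ← hH₀] at key
  set c : ℝ := (d + 1 : ℕ) * g * Fintype.card (FermionTorus (d + 1) L) / 2 with hc
  have hprinted : printedHamiltonianC κ g g' (fun (_ : Fin (d + 1)) (_ : FermionTorus (d + 1) L) => (0 : ℝ)) 0 =
      orbitalPhaseAut (g := spinSitePhase komaPhase) (fun _ => norm_komaPhase _ _) H₀ + ((-c : ℝ) : ℂ) • 1 := by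
    rw [key, Complex.ofReal_neg, neg_smul, add_neg_cancel_right]
  have hO : (printedOrder : Matrix (Finset (Orb (FermionTorus (d + 1) L))) _ ℂ) * printedOrder =
      orbitalPhaseAut (g := spinSitePhase komaPhase) (fun _ => norm_komaPhase _ _)
        (orderParameter * orderParameter) := by
    rw [map_mul, orbitalPhaseAut_orderParameter_eq_printed]
  have key := Matrix.gibbsState_unitary_conj'
    (orbitalPhase_mem_unitary (g := spinSitePhase (komaPhase (d := d) (L := L))) fun _ => norm_komaPhase _ _) β H₀
    (orderParameter * orderParameter)
  rw [star_eq_conjTranspose, ← orbitalPhaseAut_apply (fun _ => norm_komaPhase _ _),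
    ← orbitalPhaseAut_apply (fun _ => norm_komaPhase _ _)] at key
  rw [hprinted, hO, Matrix.gibbsState_add_real_smul_one, key, orderParameter, Finset.sum_mul_sum, map_sum,
    Complex.re_sum]
  refine Finset.sum_congr rfl fun x _ => ?_
  rw [map_sum, Complex.re_sum]
  refine Finset.sum_congr rfl fun y _ => ?_
  rw [pairCorr, hH₀, hamiltonianC, PairHopRP.gibbsState_gammaOne_mul_eq_coulomb]

/-- **`m^{(Λ)}_LRO = √(lroSq β H_C)`**, `H_C = H_Lieb(κ, -2Dg; g, g')`. [cite: Koma2022, (2.11), (6.18)–(6.19), §8] -/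
theorem mLROC_eq_sqrt_lroSq (hL : Even L) (h4 : 4 ≤ L) (β κ g g' : ℝ) :
    mLROC (d := d) (L := L) β κ g g' =
      Real.sqrt (lroSq β (hamiltonianC κ (-2 * (d + 1 : ℕ) * g) g g' (fun (_ _ : FermionTorus (d + 1) L) => (0 : ℝ)) 0)) := by
  have hN : (0 : ℝ) < (Fintype.card (FermionTorus (d + 1) L) : ℝ) := by
    exact_mod_cast Fintype.card_pos
  rw [mLROC, re_gibbsState_printedOrder_sq_coulomb hL h4, lroSq, Real.sqrt_div' _ (sq_nonneg _), Real.sqrt_sq hN.le]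

omit [NeZero L] in
/-- **Koma's Theorem 2.1, as printed, with the Coulomb repulsion, every dimension `D = d + 1 ≥ 3`.** For
`g > 0`, `|κ| ≤ g/1000` and `0 ≤ g' ≤ g/2000` there are `β₀ > 0` (depending on `g`, `D`) and `k₀` such that
for every `β ≥ β₀` and every `k ≥ k₀`, on the torus of side `2k` with the antiperiodic `π`-flux hopping
(2.7)–(2.9) and the interaction (2.6) (BCS pair term of strength `g` and nearest-neighbour Coulomb repulsion
`g'`): **`m^{(Λ)}_LRO ≥ 1/50`**. Hence `m_LRO = lim_Λ m^{(Λ)}_LRO > 0` ((2.12)) whenever the limit exists.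
(`κ̂ = 1/1000`, `ĝ' = 1/2000`, independent of the model parameters, as printed.) [cite: Koma2022, Theorem 2.1, §8] -/
theorem printed_superconductingOrder_coulomb (hd : 2 ≤ d) {κ g g' : ℝ} (hg : 0 < g) (hκg : |κ| ≤ g / 1000)
    (hg'0 : 0 ≤ g') (hg'g : g' ≤ g / 2000) :
    ∃ β₀ : ℝ, ∃ k₀ : ℕ, 0 < β₀ ∧ ∀ β : ℝ, β₀ ≤ β → ∀ k : ℕ, k₀ ≤ k → ∀ [NeZero (2 * k)],
      (1 / 50 : ℝ) ≤ mLROC (d := d) (L := 2 * k) β κ g g' := by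
  have hU : (-2 * (d + 1 : ℕ) * g : ℝ) + 2 * g * (d + 1) ≤ 0 := by push_cast; linarith
  obtain ⟨β₀, k₀, hβ₀, h⟩ := superconductingOrder_coulomb_abs hd hg hκg hg'0 hg'g hU
  refine ⟨β₀, max k₀ 2, hβ₀, fun β hβ k hk _ => ?_⟩
  have hk2 : 2 ≤ k := le_trans (le_max_right _ _) hk
  have h' := h β hβ k (le_trans (le_max_left _ _) hk)
  rw [mLROC_eq_sqrt_lroSq (even_two_mul k) (by omega)]
  calc (1 / 50 : ℝ) = Real.sqrt ((1 / 50) ^ 2) := (Real.sqrt_sq (by norm_num)).symm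
    _ ≤ Real.sqrt (1 / 2000) := Real.sqrt_le_sqrt (by norm_num)
    _ ≤ _ := Real.sqrt_le_sqrt h'

/-! ### The finite-volume ground states (2.13) -/

omit [NeZero L] in
/-- **Theorem 2.1 with the Coulomb term in the finite-volume ground states (Lieb frame).** In `D = d + 1 ≥ 3`
directions, for `g > 0`, `|κ| ≤ g/1000`, `0 ≤ g' ≤ g/2000` and `U + 2g(d+1) ≤ 0` there is `k₀` such that on
every torus of side `2k`, `k ≥ k₀`, the tracial ground state of `H_C` has
`|Λ|⁻²Σ_{x,y}Re ω_GS(Γ¹_xΓ¹_y) ≥ 1/2000`. [cite: Koma2022, Theorem 2.1, (2.13), §8] -/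
theorem groundState_superconductingOrder_coulomb (hd : 2 ≤ d) {κ U g g' : ℝ} (hg : 0 < g) (hκg : |κ| ≤ g / 1000)
    (hg'0 : 0 ≤ g') (hg'g : g' ≤ g / 2000) (hU : U + 2 * g * (d + 1) ≤ 0) :
    ∃ k₀ : ℕ, ∀ k : ℕ, k₀ ≤ k → ∀ [NeZero (2 * k)],
      (1 / 2000 : ℝ) ≤ groundLroSq (hamiltonianC κ U g g' (fun (_ _ : FermionTorus (d + 1) (2 * k)) => (0 : ℝ)) 0) := by
  obtain ⟨β₀, k₀, -, h⟩ := superconductingOrder_coulomb_abs hd hg hκg hg'0 hg'g hU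
  refine ⟨k₀, fun k hk _ => ?_⟩
  have hH : (hamiltonianC κ U g g' (fun (_ _ : FermionTorus (d + 1) (2 * k)) => (0 : ℝ)) 0).IsHermitian :=
    hamiltonianC_isHermitian κ U g g' _ 0
  exact ge_of_tendsto (tendsto_lroSq_atTop hH)
    ((eventually_ge_atTop β₀).mono fun β hβ => h β hβ k hk)

/-- **The zero-temperature limit of `m^{(Λ)}_LRO` exists** with the Coulomb term: `mLROC β κ g g' → √(groundLroSq H_C)`,
`H_C = H_Lieb(κ, -2Dg; g, g')` (even side `L ≥ 4`). [cite: Koma2022, (2.11), (2.13), §8] -/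
theorem tendsto_mLROC_atTop (hL : Even L) (h4 : 4 ≤ L) (κ g g' : ℝ) :
    Tendsto (fun β : ℝ => mLROC (d := d) (L := L) β κ g g') atTop
      (𝓝 (Real.sqrt (groundLroSq
        (hamiltonianC κ (-2 * (d + 1 : ℕ) * g) g g' (fun (_ _ : FermionTorus (d + 1) L) => (0 : ℝ)) 0)))) := by
  have hH : (hamiltonianC κ (-2 * (d + 1 : ℕ) * g) g g' (fun (_ _ : FermionTorus (d + 1) L) => (0 : ℝ)) 0).IsHermitian :=
    hamiltonianC_isHermitian κ _ g g' _ 0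
  have h := (Real.continuous_sqrt.tendsto _).comp (tendsto_lroSq_atTop hH)
  refine h.congr' (Eventually.of_forall fun β => ?_)
  simp only [Function.comp_apply, mLROC_eq_sqrt_lroSq hL h4]

omit [NeZero L] in
/-- **Theorem 2.1 for the finite-volume ground states (2.13) of the printed model with the Coulomb
repulsion.** In `D = d + 1 ≥ 3` directions, for `g > 0`, `|κ| ≤ g/1000` and `0 ≤ g' ≤ g/2000` there is `k₀` such
that on every torus of side `2k`, `k ≥ k₀`, the zero-temperature limit `lim_{β→∞} m^{(Λ)}_LRO` of Koma's order
parameter (2.11) exists and is at least `1/50`. [cite: Koma2022, Theorem 2.1, (2.11)–(2.13), §8] -/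
theorem printed_groundState_superconductingOrder_coulomb (hd : 2 ≤ d) {κ g g' : ℝ} (hg : 0 < g)
    (hκg : |κ| ≤ g / 1000) (hg'0 : 0 ≤ g') (hg'g : g' ≤ g / 2000) :
    ∃ k₀ : ℕ, ∀ k : ℕ, k₀ ≤ k → ∀ [NeZero (2 * k)], ∃ m₀ : ℝ, (1 / 50 : ℝ) ≤ m₀ ∧
      Tendsto (fun β : ℝ => mLROC (d := d) (L := 2 * k) β κ g g') atTop (𝓝 m₀) := by
  have hU : (-2 * (d + 1 : ℕ) * g : ℝ) + 2 * g * (d + 1) ≤ 0 := by push_cast; linarith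
  obtain ⟨k₀, h⟩ := groundState_superconductingOrder_coulomb hd hg hκg hg'0 hg'g hU
  refine ⟨max k₀ 2, fun k hk _ => ⟨_, ?_, tendsto_mLROC_atTop (even_two_mul k) (by omega) κ g g'⟩⟩
  have h' := h k (le_trans (le_max_left _ _) hk)
  calc (1 / 50 : ℝ) = Real.sqrt ((1 / 50) ^ 2) := (Real.sqrt_sq (by norm_num)).symm
    _ ≤ Real.sqrt (1 / 2000) := Real.sqrt_le_sqrt (by norm_num)
    _ ≤ _ := Real.sqrt_le_sqrt h'

end KomaPiFlux

end Literature.MathematicalPhysics.QuantumLattice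

end
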